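import Summits.BirchSwinnertonDyer.Rank1Residual.X11b.LocalTrivialityBridge
import HarnessLib

/-!
# X11b, route R1 — Castella's Selmer group OVER `K` IS a Selmer-structure Selmer group
# (`Sel_𝔭^Σ(K, M) = H¹_{𝓛^{ac,Σ}}(K, M)`, decomposition groups `D_v ≤ Γ_K` versus completions)

HONEST FRAMING (cell `b2b-bsdres`, run/shared/lean/b2b/bsd-rank1-residual/, verbatim in every
file): the goal of the cell is to DELETE the COMBINATION-SHAPED residual classes of the
Birch–Swinnerton-Dyer formula for ALL analytic-rank `≤ 1` elliptic curves over `ℚ` — "full BSD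
formula for every rank `≤ 1` curve in class `C`" assembled STRICTLY from published theorems — so
that the rank-`≤ 1` remainder becomes exactly the CONSTRUCTION-SHAPED classes, which are TYPED
(missing-input `Prop`s), NOT attempted. This is not "finishing BSD". Sub-cell
`b2b-bsdres-multr1-p1` (X11b, route R1 = Castella 2018 Thm. A re-proved along the author's
erratum); a RESEARCH ROUTE; no claim beyond the stated class; X11b stays CONSTRUCTION-SHAPED;
nothing here changes a label; no named fact is minted (two definitions with bodies — an
isomorphism `H¹(K, M) ≃+ H¹(⊤, M)` and a Selmer structure — and theorems; no `sorry`).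

## What is here

Castella's Selmer group over `K` (`AcSelmer.selmerOver ⊤ M p 𝔭 Σ`; for route R1,
`selmerAcBase W p 𝔭 Σ = Sel_𝔭^Σ(K, E[p^∞])`, the source of the control map of Cas18 Thm. 2.3 /
JSW17 §3.3) is defined by LOCAL TRIVIALITY AT DECOMPOSITION GROUPS (`awayKer`, `infKer`, and the
strict condition `strictKer` of the datum `M⁺_𝔭 = 0`).  By `LocalTrivialityBridge`
(`localization_inr_eq_zero_iff`: dying on `D_v` ⟺ dying in `H¹(K_v, M)`), each of these is a
condition `loc_v c ∈ 𝓛_v` for the Selmer structure (Mazur–Rubin Def. 2.1.1,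
`DiscreteGaloisModule.SelmerStructure`)

  `𝓛^{ac,Σ}_v = 0` at every infinite place, at `𝔭`, and at every finite `v ∉ Σ` away from `p`;
  `𝓛^{ac,Σ}_v = H¹(K_v, M)` at the other places above `p` (for `p = 𝔭𝔭̄` split: at `𝔭̄`) and on `Σ`

(`AcSelmer.acStructure ρ p 𝔭 Σ`; Cas18 Def. 2.2 at level `K`: "`H¹(K_𝔭̄, ·)` if `w = 𝔭̄`, `0` if
`w = 𝔭`", `H¹_f(K_w, E[p^∞]) = 0` at `w ∤ p` (JSW17 §2.2.3), `Σ`-imprimitivity drops the conditions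
on `Σ`).  Results:

* `LocBridge.topEquivH1 hM : H¹(K, M) ≃+ H¹(⊤, M)` (restriction along `⊤ ↪ Γ_K`, bijective) and
  `topEquivH1_mem_awayKer_iff` / `…_infKer_iff` / `…_strictKer_strictDatum_iff`: each local
  condition of `selmerOver ⊤` is `res_{D} c = 0` at the relevant decomposition group;
* `AcSelmer.mem_selmerOver_top_iff` (conjugations are trivial on `H¹(⊤, ·)`);
* **`AcSelmer.topEquivH1_mem_selmerOver_iff`: `topEquivH1 hM c ∈ selmerOver ⊤ M p 𝔭 Σ ↔
  c ∈ (acStructure (ofSMul M hM) p 𝔭 Σ).selmerGroup`** for EVERY discrete `Γ_K`-module `M` with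
  open stabilisers (so for `E[p^k]` and `E[p^∞]` alike), with the subgroup and `Nat.card` forms;
* route R1: **`AcSelmer.topEquivH1_mem_selmerAcBase_iff`**, `selmerAcBase_eq_map_selmerGroup`,
  **`natCard_selmerAcBase_eq_natCard_selmerGroup`: `#Sel_𝔭^Σ(K, E[p^∞]) = #H¹_{𝓛^{ac,Σ}}(K, E[p^∞])`**
  — the left side of (P6) `BaseSelmerCountAt` and the source of (P9) `LocSurjAt` are a Selmer
  structure's Selmer group in the vocabulary of `poitouTate_selmerStructure_duality` (Howard 2004
  Thm. 2.1.11) and `PoitouTateSelmerCounting`.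

References: [Castella2018] Def. 2.2 (arXiv:1704.06608 p. 5); [Greenberg1989] §1 p. 98;
[GreenbergLNM1716] §2; [JetchevSkinnerWan2017] §2.2.3, §3.3.1 (arXiv:1512.06894 pp. 6, 11);
[MazurRubin2004] Def. 2.1.1; [EmertonPollackWeston2006] §3.1.
-/

noncomputable section

open scoped Classical

open CategoryTheory NumberField IsDedekindDomain Field
open Literature.NumberTheory.EllipticCurves Literature.NumberTheory.EllipticCurves.GreenbergSelmer
open Literature.NumberTheory.GaloisRepresentations

universe u

namespace Summit.BirchSwinnertonDyer.Rank1Residual.X11b.LocBridge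

/-! ## §4. The three local conditions of `selmerOver ⊤` are `res_{D} = 0` -/

section Top

variable {K : Type u} [Field K]
variable {M : Type u} [AddCommGroup M] [DistribMulAction (absoluteGaloisGroup K) M]
  [TopologicalSpace M] [DiscreteTopology M]
  (hM : ∀ m : M, IsOpen {σ : absoluteGaloisGroup K | σ • m = m})

/-- **`H¹(K, M) ≃+ H¹(⊤, M)`** — restriction along `⊤ ↪ Γ_K` (`res_{Γ_K→⊤}`), bijective
(`bijective_resH1Hom_subgroupIncl`; the isomorphism "induced by `Subgroup.topEquiv`" along which
`selmerGroupOver_top` is stated), with source the type `H¹(K, M)` of the `GaloisRepresentations`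
library. Serre, *Galois Cohomology*, I.§2.4. [folklore] -/
def topEquivH1 : galoisCohomology (ofSMul M hM) 1 ≃+
    subgroupH1 (⊤ : Subgroup (absoluteGaloisGroup K)) M :=
  (toDiscreteH1 hM).trans
    (AddEquiv.ofBijective
      (resH1Hom (subgroupIncl (⊤ : Subgroup (absoluteGaloisGroup K))) (AddMonoidHom.id M)
        fun _ _ ↦ rfl)
      (bijective_resH1Hom_subgroupIncl M ⊤ Subgroup.mem_top))

variable {hM}

/-- Unfolding `topEquivH1`. [folklore] -/
theorem topEquivH1_apply (c : galoisCohomology (ofSMul M hM) 1) :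
    topEquivH1 hM c = resH1Hom (subgroupIncl (⊤ : Subgroup (absoluteGaloisGroup K)))
      (AddMonoidHom.id M) (fun _ _ ↦ rfl) (toDiscreteH1 hM c) :=
  rfl

/-- `res_{⊤→H} (topEquivH1 c) = res_{Γ_K→H} c` (`resOfLe_top_comp_resH1Hom_subgroupIncl`).
[folklore] -/
theorem resOfLe_topEquivH1 (H : Subgroup (absoluteGaloisGroup K)) (hle : H ≤ ⊤)
    (c : galoisCohomology (ofSMul M hM) 1) :
    resOfLe M hle (topEquivH1 hM c) = ResKernel.resSubgroup H M (toDiscreteH1 hM c) := by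
  rw [topEquivH1_apply, ← AddMonoidHom.comp_apply, AcSelmer.resOfLe_top_comp_resH1Hom_subgroupIncl]

variable [NumberField K]

/-- **The away condition is `res_{D_v} = 0`**: `topEquivH1 c ∈ awayKer ⊤ M v` (dies on `⊤ ⊓ D_v`)
iff `res_{D_v} c = 0`. [cite: EmertonPollackWeston2006, §3.1] [cite: GreenbergLNM1716, §2] -/
theorem topEquivH1_mem_awayKer_iff (v : HeightOneSpectrum (𝓞 K))
    (c : galoisCohomology (ofSMul M hM) 1) :
    topEquivH1 hM c ∈ awayKer ⊤ M v ↔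
      ResKernel.resSubgroup (decomp v) M (toDiscreteH1 hM c) = 0 := by
  rw [awayKer, AddMonoidHom.mem_ker, resOfLe_topEquivH1]
  exact resSubgroup_eq_zero_iff_of_coe_eq (by simp) _

omit [NumberField K] in
/-- The infinite condition is `res_{D_w} = 0`: `topEquivH1 c ∈ infKer ⊤ M w` iff
`res_{decompInf w} c = 0`. [cite: Greenberg1989, §1 p. 98 (3)] -/
theorem topEquivH1_mem_infKer_iff (w : InfinitePlace K)
    (c : galoisCohomology (ofSMul M hM) 1) :
    topEquivH1 hM c ∈ infKer ⊤ M w ↔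
      ResKernel.resSubgroup (decompInf w) M (toDiscreteH1 hM c) = 0 := by
  rw [infKer, AddMonoidHom.mem_ker, resOfLe_topEquivH1]
  exact resSubgroup_eq_zero_iff_of_coe_eq (by simp) _

/-- **The STRICT condition for Castella's datum `M⁺_𝔭 = 0` is `res_{D_𝔭} = 0`**: the strict map is
the map of the pair `(⊤ ⊓ D_𝔭 ↪ ⊤, M ↠ M ⧸ 0)`, whose coefficient map is bijective and whose group
map, composed with `⊤ ↪ Γ_K`, has range `D_𝔭`. [cite: Greenberg1989, §1 p. 98 (strict condition)]
[cite: Castella2018, §2.1 Def. 2.1–2.2 (arXiv:1704.06608 p. 5), "`0` if `w = 𝔭`"] -/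
theorem topEquivH1_mem_strictKer_strictDatum_iff (𝔭 : HeightOneSpectrum (𝓞 K))
    (c : galoisCohomology (ofSMul M hM) 1) :
    topEquivH1 hM c ∈ (AcSelmer.strictDatum M 𝔭).strictKer ⊤ ↔
      ResKernel.resSubgroup (decomp 𝔭) M (toDiscreteH1 hM c) = 0 := by
  rw [LocalDatum.mem_strictKer_iff, LocalDatum.strictMap, topEquivH1_apply, resH1Hom_resH1Hom,
    ResKernel.resSubgroup]
  have hbij : Function.Bijective
      (((AcSelmer.strictDatum M 𝔭).grMk).comp (AddMonoidHom.id M)) := by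
    refine ⟨fun a b hab ↦ ?_, fun q ↦ ?_⟩
    · have h : a - b ∈ (AcSelmer.strictDatum M 𝔭).grMk.ker := by
        rw [AddMonoidHom.mem_ker, map_sub, sub_eq_zero]; exact hab
      rw [LocalDatum.ker_grMk] at h
      exact sub_eq_zero.mp (AddSubgroup.mem_bot.mp h)
    · obtain ⟨m, rfl⟩ := (AcSelmer.strictDatum M 𝔭).grMk_surjective q
      exact ⟨m, rfl⟩
  refine resH1Hom_eq_zero_iff_of_range_eq _ _ _ hbij _ _ _ Function.bijective_id ?_ _
  rw [range_subgroupIncl]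
  ext g
  simp only [Set.mem_range, ContinuousMonoidHom.comp_toFun, subgroupIncl_apply, SetLike.mem_coe]
  constructor
  · rintro ⟨x, rfl⟩
    exact (x : decomp 𝔭).2
  · intro hg
    exact ⟨⟨⟨g, hg⟩, (mem_decompIn_iff ⊤ 𝔭 ⟨g, hg⟩).2 (Subgroup.mem_top _)⟩, rfl⟩

end Top

end Summit.BirchSwinnertonDyer.Rank1Residual.X11b.LocBridge

/-! ## §5. Castella's Selmer structure over `K` and the identification -/

namespace Summit.BirchSwinnertonDyer.Rank1Residual.X11b.AcSelmer

open Summit.BirchSwinnertonDyer.Rank1Residual.X11b.LocBridge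
open Literature.NumberTheory.GaloisRepresentations.DiscreteGaloisModule (SelmerStructure)

variable {K : Type u} [Field K] [NumberField K]

section Structure

variable {M : Type u} [AddCommGroup M] [TopologicalSpace M] [DiscreteTopology M]

/-- **Castella's local conditions over `K` as a Selmer structure** `𝓛^{ac,Σ}_𝔭` on a discrete Galois
module `ρ` (Cas18 Def. 2.2 at level `K`, in the vocabulary of Mazur–Rubin Def. 2.1.1 /
`DiscreteGaloisModule.SelmerStructure`): the ZERO condition at every infinite place, at the
distinguished place `𝔭`, and at every finite `v ∉ Σ` away from `p` ("`0` if `w = 𝔭`", "`H¹_f = 0`" at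
`w ∤ p` for `E[p^∞]`, JSW17 §2.2.3); NO condition at the other places above `p` ("`H¹(K_𝔭̄, ·)`
if `w = 𝔭̄`") and at the places of `Σ` (`Σ`-imprimitivity).  A definition; nothing asserted.
[cite: Castella2018, Def. 2.2 (arXiv:1704.06608 p. 5)]
[cite: JetchevSkinnerWan2017, §2.2.3 (arXiv:1512.06894 p. 6) (anticyclotomic local conditions)] -/
def acStructure (ρ : DiscreteGaloisModule K M) (p : ℕ) (𝔭 : HeightOneSpectrum (𝓞 K))
    (S : Set (HeightOneSpectrum (𝓞 K))) : SelmerStructure ρ := fun v ↦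
  match v with
  | Sum.inl _ => ⊥
  | Sum.inr v => if v = 𝔭 ∨ (((p : ℕ) : 𝓞 K) ∉ v.asIdeal ∧ v ∉ S) then ⊥ else ⊤

variable (ρ : DiscreteGaloisModule K M) (p : ℕ) (𝔭 : HeightOneSpectrum (𝓞 K))
  (S : Set (HeightOneSpectrum (𝓞 K)))

/-- `𝓛^{ac,Σ}` at an infinite place: `0`. [cite: Castella2018, Def. 2.2 (arXiv:1704.06608 p. 5)] -/
@[simp]
theorem acStructure_inl (w : InfinitePlace K) : acStructure ρ p 𝔭 S (Sum.inl w) = ⊥ :=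
  rfl

/-- Unfolding `𝓛^{ac,Σ}` at a finite place. [cite: Castella2018, Def. 2.2 (arXiv:1704.06608 p. 5)] -/
theorem acStructure_inr (v : HeightOneSpectrum (𝓞 K)) :
    acStructure ρ p 𝔭 S (Sum.inr v) =
      if v = 𝔭 ∨ (((p : ℕ) : 𝓞 K) ∉ v.asIdeal ∧ v ∉ S) then ⊥ else ⊤ :=
  rfl

/-- `𝓛^{ac,Σ}` at `𝔭`: `0` (strict). [cite: Castella2018, Def. 2.2 (arXiv:1704.06608 p. 5)] -/
theorem acStructure_self : acStructure ρ p 𝔭 S (Sum.inr 𝔭) = ⊥ := by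
  rw [acStructure_inr, if_pos (Or.inl rfl)]

/-- `𝓛^{ac,Σ}` at a finite `v ∤ p`, `v ∉ Σ`: `0` (locally trivial).
[cite: Castella2018, Def. 2.2 (arXiv:1704.06608 p. 5)] -/
theorem acStructure_of_not_mem {v : HeightOneSpectrum (𝓞 K)} (hv : ((p : ℕ) : 𝓞 K) ∉ v.asIdeal)
    (hvS : v ∉ S) : acStructure ρ p 𝔭 S (Sum.inr v) = ⊥ := by
  rw [acStructure_inr, if_pos (Or.inr ⟨hv, hvS⟩)]

/-- `𝓛^{ac,Σ}` at a place above `p` other than `𝔭`: everything (relaxed).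
[cite: Castella2018, Def. 2.2 (arXiv:1704.06608 p. 5)] -/
theorem acStructure_of_mem_of_ne {v : HeightOneSpectrum (𝓞 K)} (hv : ((p : ℕ) : 𝓞 K) ∈ v.asIdeal)
    (hne : v ≠ 𝔭) : acStructure ρ p 𝔭 S (Sum.inr v) = ⊤ := by
  rw [acStructure_inr, if_neg (by tauto)]

/-- `𝓛^{ac,Σ}` at a place of `Σ` other than `𝔭`: everything (`Σ`-imprimitive).
[cite: Castella2018, Def. 2.2 (arXiv:1704.06608 p. 5)] -/
theorem acStructure_of_mem_S {v : HeightOneSpectrum (𝓞 K)} (hvS : v ∈ S) (hne : v ≠ 𝔭) :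
    acStructure ρ p 𝔭 S (Sum.inr v) = ⊤ := by
  rw [acStructure_inr, if_neg (by tauto)]

/-- `Σ ⊆ Σ'` ⟹ `𝓛^{ac,Σ} ≤ 𝓛^{ac,Σ'}`. [cite: Castella2018, Def. 2.2 (arXiv:1704.06608 p. 5)] -/
theorem acStructure_mono {S S' : Set (HeightOneSpectrum (𝓞 K))} (h : S ⊆ S') :
    acStructure ρ p 𝔭 S ≤ acStructure ρ p 𝔭 S' := by
  intro v
  cases v with
  | inl w => exact le_rfl
  | inr v =>
    rw [acStructure_inr, acStructure_inr]
    by_cases h1 : v = 𝔭 ∨ (((p : ℕ) : 𝓞 K) ∉ v.asIdeal ∧ v ∉ S')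
    · have h2 : v = 𝔭 ∨ (((p : ℕ) : 𝓞 K) ∉ v.asIdeal ∧ v ∉ S) :=
        h1.imp id fun h' ↦ ⟨h'.1, fun hv ↦ h'.2 (h hv)⟩
      rw [if_pos h1, if_pos h2]
    · rw [if_neg h1]
      exact le_top

end Structure

section Identification

variable {M : Type u} [AddCommGroup M] [DistribMulAction (absoluteGaloisGroup K) M]
  [TopologicalSpace M] [DiscreteTopology M]
  (hM : ∀ m : M, IsOpen {σ : absoluteGaloisGroup K | σ • m = m})

omit [NumberField K] in
/-- On `H¹(⊤, M)` every conjugation `conj_σ` is the identity (`conjH1_of_mem_holds`), so membership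
in `selmerOver ⊤ M p 𝔭 Σ` is: away condition at every finite `v ∤ p`, `v ∉ Σ`; infinite condition
at every `w`; strict condition at `𝔭`. [cite: Castella2018, Def. 2.2 (arXiv:1704.06608 p. 5)] -/
theorem mem_selmerOver_top_iff [NumberField K] {p : ℕ} {𝔭 : HeightOneSpectrum (𝓞 K)}
    {S : Set (HeightOneSpectrum (𝓞 K))} (c : subgroupH1 (⊤ : Subgroup (absoluteGaloisGroup K)) M) :
    c ∈ selmerOver ⊤ M p 𝔭 S ↔
      (∀ v : HeightOneSpectrum (𝓞 K), ((p : ℕ) : 𝓞 K) ∉ v.asIdeal → v ∉ S → c ∈ awayKer ⊤ M v) ∧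
        (∀ w : InfinitePlace K, c ∈ infKer ⊤ M w) ∧ c ∈ (strictDatum M 𝔭).strictKer ⊤ := by
  have e : ∀ σ : absoluteGaloisGroup K, conjH1 ⊤ M σ c = c := fun σ ↦ by
    rw [conjH1_of_mem_holds ⊤ M (Subgroup.mem_top σ), AddMonoidHom.id_apply]
  rw [mem_selmerOver_iff]
  simp only [e]
  exact ⟨fun h ↦ ⟨fun v hv hvS ↦ h.1 v hv hvS 1, fun w ↦ h.2.1 w 1, h.2.2 1⟩,
    fun h ↦ ⟨fun v hv hvS _ ↦ h.1 v hv hvS, fun w _ ↦ h.2.1 w, fun _ ↦ h.2.2⟩⟩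

/-- **Castella's Selmer group over `K` IS the Selmer group of `𝓛^{ac,Σ}`.**  For every discrete
`Γ_K`-module `M` with open stabilisers, every `p`, `𝔭`, `Σ`: a class `c ∈ H¹(K, M)` lies in
`H¹_{𝓛^{ac,Σ}}(K, M)` (`SelmerStructure.selmerGroup`, localisations to the completions `K_v`) iff
`topEquivH1 c ∈ selmerOver ⊤ M p 𝔭 Σ` (Castella's conditions at the decomposition groups).
[cite: Castella2018, Def. 2.2 (arXiv:1704.06608 p. 5)] [cite: GreenbergLNM1716, §2] -/
theorem topEquivH1_mem_selmerOver_iff (p : ℕ) (𝔭 : HeightOneSpectrum (𝓞 K))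
    (S : Set (HeightOneSpectrum (𝓞 K))) (c : galoisCohomology (ofSMul M hM) 1) :
    topEquivH1 hM c ∈ selmerOver ⊤ M p 𝔭 S ↔
      c ∈ (acStructure (ofSMul M hM) p 𝔭 S).selmerGroup := by
  rw [mem_selmerOver_top_iff, SelmerStructure.mem_selmerGroup_iff]
  have hA : ∀ v : HeightOneSpectrum (𝓞 K), topEquivH1 hM c ∈ awayKer ⊤ M v ↔
      galoisCohomology.localization (ofSMul M hM) (Sum.inr v) 1 c = 0 := fun v ↦
    (topEquivH1_mem_awayKer_iff v c).trans (localization_inr_eq_zero_iff hM v c).symm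
  have hI : ∀ w : InfinitePlace K, topEquivH1 hM c ∈ infKer ⊤ M w ↔
      galoisCohomology.localization (ofSMul M hM) (Sum.inl w) 1 c = 0 := fun w ↦
    (topEquivH1_mem_infKer_iff w c).trans (localization_inl_eq_zero_iff hM w c).symm
  have hS : topEquivH1 hM c ∈ (strictDatum M 𝔭).strictKer ⊤ ↔
      galoisCohomology.localization (ofSMul M hM) (Sum.inr 𝔭) 1 c = 0 :=
    (topEquivH1_mem_strictKer_strictDatum_iff 𝔭 c).trans (localization_inr_eq_zero_iff hM 𝔭 c).symm
  constructor
  · rintro ⟨hA', hI', hS'⟩ v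
    cases v with
    | inl w =>
      rw [acStructure_inl, AddSubgroup.mem_bot]
      exact (hI w).mp (hI' w)
    | inr v =>
      rw [acStructure_inr]
      by_cases h1 : v = 𝔭 ∨ (((p : ℕ) : 𝓞 K) ∉ v.asIdeal ∧ v ∉ S)
      · rw [if_pos h1, AddSubgroup.mem_bot]
        rcases h1 with rfl | ⟨hv, hvS⟩
        · exact hS.mp hS'
        · exact (hA v).mp (hA' v hv hvS)
      · rw [if_neg h1]
        exact AddSubgroup.mem_top _
  · intro h
    refine ⟨fun v hv hvS ↦ (hA v).mpr ?_, fun w ↦ (hI w).mpr ?_, hS.mpr ?_⟩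
    · have h1 := h (Sum.inr v)
      rwa [acStructure_of_not_mem _ p 𝔭 S hv hvS, AddSubgroup.mem_bot] at h1
    · have h1 := h (Sum.inl w)
      rwa [acStructure_inl, AddSubgroup.mem_bot] at h1
    · have h1 := h (Sum.inr 𝔭)
      rwa [acStructure_self, AddSubgroup.mem_bot] at h1

/-- Subgroup form: `selmerOver ⊤ M p 𝔭 Σ` is the image of `H¹_{𝓛^{ac,Σ}}(K, M)` under `topEquivH1`.
[cite: Castella2018, Def. 2.2 (arXiv:1704.06608 p. 5)] -/
theorem selmerOver_top_eq_map_selmerGroup (p : ℕ) (𝔭 : HeightOneSpectrum (𝓞 K))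
    (S : Set (HeightOneSpectrum (𝓞 K))) :
    selmerOver ⊤ M p 𝔭 S =
      ((acStructure (ofSMul M hM) p 𝔭 S).selmerGroup).map (topEquivH1 hM).toAddMonoidHom := by
  ext c
  rw [AddSubgroup.mem_map]
  constructor
  · intro hc
    refine ⟨(topEquivH1 hM).symm c, ?_, (topEquivH1 hM).apply_symm_apply c⟩
    rw [← topEquivH1_mem_selmerOver_iff hM, AddEquiv.apply_symm_apply]
    exact hc
  · rintro ⟨c', hc', rfl⟩
    exact (topEquivH1_mem_selmerOver_iff hM p 𝔭 S c').2 hc'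

/-- Cardinality form: `#selmerOver ⊤ M p 𝔭 Σ = #H¹_{𝓛^{ac,Σ}}(K, M)` (`Nat.card`; no finiteness
needed). [cite: Castella2018, Def. 2.2 (arXiv:1704.06608 p. 5)] -/
theorem natCard_selmerOver_top_eq (p : ℕ) (𝔭 : HeightOneSpectrum (𝓞 K))
    (S : Set (HeightOneSpectrum (𝓞 K))) :
    Nat.card (selmerOver ⊤ M p 𝔭 S) =
      Nat.card ((acStructure (ofSMul M hM) p 𝔭 S).selmerGroup) := by
  rw [selmerOver_top_eq_map_selmerGroup hM]
  exact Nat.card_congr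
    ((topEquivH1 hM).addSubgroupMap (acStructure (ofSMul M hM) p 𝔭 S).selmerGroup).symm.toEquiv

end Identification

section Curve

variable (W : WeierstrassCurve K) (p : ℕ) (𝔭 : HeightOneSpectrum (𝓞 K))
  (S : Set (HeightOneSpectrum (𝓞 K)))

/-- **Route R1: `Sel_𝔭^Σ(K, E[p^∞])` (the source of the control map, `selmerAcBase`) is
`H¹_{𝓛^{ac,Σ}}(K, E[p^∞])` for the discrete Galois module `primaryGaloisModule W p`.**  Hence the
Poitou–Tate atoms (P6)/(P9)/(L10) of `AnticyclotomicControlAtoms` are statements about a Selmer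
group in the sense of Mazur–Rubin Def. 2.1.1, the vocabulary of
`poitouTate_selmerStructure_duality`. [cite: Castella2018, Def. 2.2 (arXiv:1704.06608 p. 5)]
[cite: JetchevSkinnerWan2017, §3.3.1 (arXiv:1512.06894 p. 11)] -/
theorem topEquivH1_mem_selmerAcBase_iff [Fact p.Prime]
    (c : galoisCohomology (primaryGaloisModule W p) 1) :
    topEquivH1 (isOpen_stabilizer_geomPrimaryTorsion W p) c ∈ selmerAcBase W p 𝔭 S ↔
      c ∈ (acStructure (primaryGaloisModule W p) p 𝔭 S).selmerGroup :=
  topEquivH1_mem_selmerOver_iff (isOpen_stabilizer_geomPrimaryTorsion W p) p 𝔭 S c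

/-- Subgroup form of `topEquivH1_mem_selmerAcBase_iff`.
[cite: Castella2018, Def. 2.2 (arXiv:1704.06608 p. 5)] -/
theorem selmerAcBase_eq_map_selmerGroup [Fact p.Prime] :
    selmerAcBase W p 𝔭 S =
      ((acStructure (primaryGaloisModule W p) p 𝔭 S).selmerGroup).map
        (topEquivH1 (isOpen_stabilizer_geomPrimaryTorsion W p)).toAddMonoidHom :=
  selmerOver_top_eq_map_selmerGroup (isOpen_stabilizer_geomPrimaryTorsion W p) p 𝔭 S

/-- Cardinality form: `#Sel_𝔭^Σ(K, E[p^∞]) = #H¹_{𝓛^{ac,Σ}}(K, E[p^∞])` (`Nat.card`, no finiteness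
needed) — the left side of (P6) `BaseSelmerCountAt` is a Selmer-structure count.
[cite: Castella2018, Def. 2.2 (arXiv:1704.06608 p. 5)]
[cite: JetchevSkinnerWan2017, Prop. 3.2.1 (arXiv:1512.06894 p. 10) (shape only)] -/
theorem natCard_selmerAcBase_eq_natCard_selmerGroup [Fact p.Prime] :
    Nat.card (selmerAcBase W p 𝔭 S) =
      Nat.card ((acStructure (primaryGaloisModule W p) p 𝔭 S).selmerGroup) :=
  natCard_selmerOver_top_eq (isOpen_stabilizer_geomPrimaryTorsion W p) p 𝔭 S

end Curve

end Summit.BirchSwinnertonDyer.Rank1Residual.X11b.AcSelmer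

end
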